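import Summits.CriticalPhenomena.SAWScalingLimit.Theorems.SAWLoopFugacityFlowIsingBoundaryRatioWindowCrossingChart
import HarnessLib

/-!
# Radial crossings pass through the window rectangle — a lattice walk across a chart band meets a cross-cut
(line `fk-anchor-transfer`, crux `IsingBoundaryRatio`, stmt-CriticalPhenomena-10650; third helper module of the
proof of `AnnCrossThroughWindowRect`)

`exists_dart_of_crosscut`: in the chordal chart `g` (extended `φ⁻¹`), a path `L` of `closure D` whose chart
values stay in the closed half-annulus `{r - m ≤ |w| ≤ r + m}` and whose feet have arguments `0` and `π`, and
the polyline of a walk of the mesh graph `Ω_δ` from chart radius `≤ r - m` to chart radius `≥ r + m`, meet: a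
point of `L` lies on the closed segment of a dart of the walk. Proof as in `annSideCrossSeparation`
(`…IsingBoundaryRatioSideCrossSeparation.lean`): trim the polyline to the band (`exists_trimmed_interval`), pass
to the coordinates `log |w| + i arg w` (`pol`), where the band is a rectangle joined horizontally by the polyline
and vertically by `L`, and apply Maehara's crossing lemma `exists_mem_of_crossing`; `pol` and `g` are injective.

References: R. Maehara, Amer. Math. Monthly 91 (1984) (crossing lemma).
-/

noncomputable section

open scoped Classical Topology
open Filter Set Metric SimpleGraph Complex
open Literature.Probability.LatticeModels Literature.Probability.RandomPlanarGeometry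
open Literature.Probability.Percolation (BondConfig)
open Literature.Topology.PlaneTopology
open UpperHalfPlane (upperHalfPlaneSet)

namespace Summit.CriticalPhenomena.SAWScalingLimit.Theorems.IsingBoundaryRatio

set_option maxHeartbeats 1000000 in
/-- **A lattice walk across a chart band meets every cross-cut of the band** (see the module docstring).
[folklore] -/
theorem exists_dart_of_crosscut {D : DobrushinDomain} {φ : ConformalEquiv upperHalfPlaneSet D.carrier}
    {g : ℂ → ℂ} {B : Set ℂ} {d m r R δ : ℝ}
    (hBc : IsCompact B) (hgB : ContinuousOn g B) (hginj : InjOn g B)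
    (hgeq : EqOn g φ.symm D.carrier) (hgim : ∀ z ∈ B, 0 ≤ (g z).im)
    (hmemB : ∀ z ∈ closure D.carrier, d / 2 ≤ dist z (D.pt 1) → z ∈ B)
    (hfar : ∀ z ∈ D.carrier, ‖φ.symm z‖ ≤ R → d ≤ dist z (D.pt 1))
    (hδ : 0 < δ) (hδd : 2 * δ ≤ d) (hm : 0 < m) (hmr : m < r)
    {qp qm : ℂ} (L : Path qp qm) (hL : ∀ t, L t ∈ B ∧ r - m ≤ ‖g (L t)‖ ∧ ‖g (L t)‖ ≤ r + m)
    (hqp : arg (g qp) = 0) (hqm : arg (g qm) = Real.pi)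
    {u v : Site 2} (W : (discreteDomainGraph D.carrier δ).Walk u v)
    (hu : ‖φ.symm (meshPoint δ u)‖ ≤ r - m) (hv : r + m ≤ ‖φ.symm (meshPoint δ v)‖)
    (hW : ∀ e ∈ W.darts, ‖φ.symm (meshPoint δ e.fst)‖ ≤ R) :
    ∃ y ∈ range L, ∃ e ∈ W.darts, y ∈ segment ℝ (meshPoint δ e.fst) (meshPoint δ e.snd) := by
  have hd : 0 < d := by linarith
  have hrm : 0 < r - m := by linarith
  -- basic lattice facts
  have hdartD : ∀ {x y : Site 2}, (discreteDomainGraph D.carrier δ).Adj x y →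
      meshPoint δ x ∈ D.carrier ∧ meshPoint δ y ∈ D.carrier ∧ (zdGraph 2).Adj x y ∧
        segment ℝ (meshPoint δ x) (meshPoint δ y) ⊆ closure D.carrier ∧
        dist (meshPoint δ y) (meshPoint δ x) ≤ δ := by
    intro x y h
    obtain ⟨hmg, hx, hy⟩ := discreteDomainGraph_adj_iff.1 h
    obtain ⟨hzd, hseg⟩ := meshGraph_adj_iff.1 hmg
    refine ⟨meshDomain_subset_meshVertices _ _ hx, meshDomain_subset_meshVertices _ _ hy, hzd, hseg, ?_⟩
    rw [_root_.dist_comm]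
    have := (Literature.Probability.Percolation.dist_meshPoint_of_adj (δ := δ) hzd).le
    rwa [abs_of_pos hδ] at this
  have hW0 : 0 < W.length := by
    rcases Nat.eq_zero_or_pos W.length with h | h
    · exfalso
      have huv : u = v := Walk.eq_of_length_eq_zero h
      rw [huv] at hu
      linarith
    · exact h
  set emb : Site 2 → ℂ := meshPoint δ with hemb
  -- points of the polyline are in `B`, close to a dart start in `B ∩ D`
  have hpolyB : ∀ z ∈ range (walkPath emb W), ∃ e ∈ W.darts,
      z ∈ segment ℝ (meshPoint δ e.fst) (meshPoint δ e.snd) ∧ z ∈ B ∧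
        meshPoint δ e.fst ∈ B ∧ meshPoint δ e.fst ∈ D.carrier := by
    intro z hz
    obtain ⟨e, he, hze⟩ := exists_dart_of_mem_range_walkPath W hW0 hz
    obtain ⟨hxD, -, -, hseg, hdist⟩ := hdartD e.adj
    have hxb : d ≤ dist (meshPoint δ e.fst) (D.pt 1) := hfar _ hxD (hW e he)
    have hzx : dist z (meshPoint δ e.fst) ≤ δ :=
      (convex_closedBall _ _).segment_subset (mem_closedBall_self hδ.le) (mem_closedBall.2 hdist) hze
    refine ⟨e, he, hze, hmemB z (hseg hze) ?_, hmemB _ (subset_closure hxD) (by linarith), hxD⟩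
    linarith [dist_triangle (meshPoint δ e.fst) z (D.pt 1), _root_.dist_comm z (meshPoint δ e.fst)]
  -- the band `S` in the chart and the rectangle in log-polar coordinates
  set S : Set ℂ := {z | z ∈ B ∧ r - m ≤ ‖g z‖ ∧ ‖g z‖ ≤ r + m} with hS
  have hSB : S ⊆ B := fun z hz => hz.1
  have hgS : MapsTo g S {w : ℂ | w ≠ 0 ∧ 0 ≤ w.im} := fun z hz =>
    ⟨fun h => by have := hz.2.1; rw [h, norm_zero] at this; linarith, hgim z hz.1⟩
  have hpolg : ContinuousOn (fun z => pol (g z)) S := continuousOn_pol.comp (hgB.mono hSB) hgS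
  have hrect : ∀ z ∈ S, pol (g z) ∈ Icc (Real.log (r - m)) (Real.log (r + m)) ×ℂ Icc 0 Real.pi := fun z hz =>
    pol_mem_rect hrm hz.2.1 hz.2.2 (hgim z hz.1)
  -- the cross-cut in coordinates
  have hLS : ∀ t, L.extend t ∈ S := by
    intro t
    have ht : L.extend t ∈ range L := by rw [← Path.extend_range]; exact mem_range_self t
    obtain ⟨t', ht'⟩ := ht
    rw [← ht']
    exact hL t'
  set β : ℝ → ℂ := fun t => pol (g (L.extend t)) with hβ
  have hβc : ContinuousOn β (Icc 0 1) := hpolg.comp L.continuous_extend.continuousOn fun t _ => hLS t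
  have hβK : MapsTo β (Icc 0 1) (Icc (Real.log (r - m)) (Real.log (r + m)) ×ℂ Icc 0 Real.pi) :=
    fun t _ => hrect _ (hLS t)
  have hβ0 : (β 0).im = 0 := by simp only [hβ, Path.extend_zero, pol_im]; exact hqp
  have hβ1 : (β 1).im = Real.pi := by simp only [hβ, Path.extend_one, pol_im]; exact hqm
  -- the polyline of `W`, trimmed to the band
  set Γ : ℝ → ℂ := ⇑((walkPath emb W).extend) with hΓ
  have hΓB : ∀ t, Γ t ∈ B := fun t =>
    (hpolyB _ (by rw [hΓ, ← Path.extend_range]; exact mem_range_self t)).choose_spec.2.2.1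
  set 𝒜 : Set ℂ := B ∩ g ⁻¹' closedBall 0 (r - m) with h𝒜
  set ℬ : Set ℂ := B ∩ g ⁻¹' {w | r + m ≤ ‖w‖} with hℬ
  have h𝒜c : IsClosed 𝒜 := hgB.preimage_isClosed_of_isClosed hBc.isClosed isClosed_closedBall
  have hℬc : IsClosed ℬ :=
    hgB.preimage_isClosed_of_isClosed hBc.isClosed (isClosed_le continuous_const continuous_norm)
  have hΓ0 : Γ 0 = meshPoint δ u := (walkPath emb W).extend_zero
  have hΓ1 : Γ 1 = meshPoint δ v := (walkPath emb W).extend_one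
  have huD : meshPoint δ u ∈ D.carrier := by
    obtain ⟨e, he, rfl⟩ := exists_dart_fst_eq W hW0
    exact (hdartD e.adj).1
  have hvD : meshPoint δ v ∈ D.carrier := by
    obtain ⟨e, he, rfl⟩ := exists_dart_snd_eq W hW0
    exact (hdartD e.adj).2.1
  obtain ⟨u₁, v₁, hu₁0, hu₁v₁, hv₁1, hΓu₁, hΓv₁, hΓint⟩ :=
    exists_trimmed_interval (Γ := Γ) (walkPath emb W).continuous_extend h𝒜c hℬc zero_lt_one
      (show Γ 0 ∈ 𝒜 from ⟨hΓB 0, by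
        rw [mem_preimage, hΓ0, hgeq huD]; exact mem_closedBall_zero_iff.2 hu⟩)
      (show Γ 1 ∈ ℬ from ⟨hΓB 1, by rw [mem_preimage, hΓ1, hgeq hvD]; exact hv⟩)
      (fun x _ hxA hxB => by
        have h1' : ‖g (Γ x)‖ ≤ r - m := mem_closedBall_zero_iff.1 hxA.2
        have h2' : r + m ≤ ‖g (Γ x)‖ := hxB.2
        linarith)
  have hΓS : ∀ x ∈ Icc u₁ v₁, Γ x ∈ S := by
    set T : Set ℝ := Icc u₁ v₁ ∩ (fun x => ‖g (Γ x)‖) ⁻¹' Icc (r - m) (r + m) with hT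
    have hclosed : IsClosed T := by
      have hc : ContinuousOn (fun x => ‖g (Γ x)‖) (Icc u₁ v₁) :=
        continuous_norm.comp_continuousOn
          (hgB.comp (walkPath emb W).continuous_extend.continuousOn fun x _ => hΓB x)
      exact hc.preimage_isClosed_of_isClosed isClosed_Icc isClosed_Icc
    have hsub : Ioo u₁ v₁ ⊆ T := by
      intro x hx
      obtain ⟨hxA, hxB⟩ := hΓint x hx
      refine ⟨Ioo_subset_Icc_self hx, ?_, ?_⟩
      · by_contra h; push Not at h
        exact hxA ⟨hΓB x, mem_closedBall_zero_iff.2 h.le⟩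
      · by_contra h; push Not at h
        exact hxB ⟨hΓB x, h.le⟩
    have hcl : closure (Ioo u₁ v₁) ⊆ T := closure_minimal hsub hclosed
    rw [closure_Ioo hu₁v₁.ne] at hcl
    intro x hx
    exact ⟨hΓB x, (hcl hx).2⟩
  have hΓu₁' : ‖g (Γ u₁)‖ = r - m :=
    le_antisymm (mem_closedBall_zero_iff.1 hΓu₁.2) (hΓS u₁ (left_mem_Icc.2 hu₁v₁.le)).2.1
  have hΓv₁' : ‖g (Γ v₁)‖ = r + m := le_antisymm (hΓS v₁ (right_mem_Icc.2 hu₁v₁.le)).2.2 hΓv₁.2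
  set γc : ℝ → ℂ := fun s' => Γ (u₁ + s' * (v₁ - u₁)) with hγc
  have hγcmem : ∀ s' ∈ Icc (0 : ℝ) 1, u₁ + s' * (v₁ - u₁) ∈ Icc u₁ v₁ := by
    intro s' hs'
    constructor <;> nlinarith [hs'.1, hs'.2, hu₁v₁]
  set γ : ℝ → ℂ := fun s' => pol (g (γc s')) with hγ
  have hγcc : Continuous γc := (walkPath emb W).continuous_extend.comp (by fun_prop)
  have hγc' : ContinuousOn γ (Icc 0 1) := hpolg.comp hγcc.continuousOn fun s' hs' => hΓS _ (hγcmem s' hs')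
  have hγK : MapsTo γ (Icc 0 1) (Icc (Real.log (r - m)) (Real.log (r + m)) ×ℂ Icc 0 Real.pi) :=
    fun s' hs' => hrect _ (hΓS _ (hγcmem s' hs'))
  have hγ0 : (γ 0).re = Real.log (r - m) := by simp [hγ, hγc, hΓu₁']
  have hγ1 : (γ 1).re = Real.log (r + m) := by simp [hγ, hγc, hΓv₁']
  -- the two curves meet
  obtain ⟨s', hs', t, -, hst⟩ := exists_mem_of_crossing hβc hγc' hβK hγK hβ0 hβ1 hγ0 hγ1
  have hzS : L.extend t ∈ S := hLS t
  have hz'S : γc s' ∈ S := hΓS _ (hγcmem s' hs')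
  have hgzz : g (L.extend t) = g (γc s') := injOn_pol (hgS hzS) (hgS hz'S) hst
  have hzz : L.extend t = γc s' := hginj hzS.1 hz'S.1 hgzz
  have hzL : L.extend t ∈ range L := by rw [← Path.extend_range]; exact mem_range_self t
  have hzq : L.extend t ∈ range (walkPath emb W) := by
    rw [hzz, hγc, hΓ, ← Path.extend_range]; exact mem_range_self _
  obtain ⟨e', he', hze'⟩ := exists_dart_of_mem_range_walkPath W hW0 hzq
  exact ⟨L.extend t, hzL, e', he', hze'⟩

/-- A lattice walk across a chart band meets every cross-cut of the band, closed form (registered sub-goal of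
stmt-CriticalPhenomena-10650). [folklore] -/
theorem exists_dart_of_crosscut' : ∀ {D : DobrushinDomain} {φ : ConformalEquiv upperHalfPlaneSet D.carrier} {g : ℂ → ℂ} {B : Set ℂ} {d m r R δ : ℝ}, IsCompact B → ContinuousOn g B → InjOn g B → EqOn g φ.symm D.carrier → (∀ z ∈ B, 0 ≤ (g z).im) → (∀ z ∈ closure D.carrier, d / 2 ≤ dist z (D.pt 1) → z ∈ B) → (∀ z ∈ D.carrier, ‖φ.symm z‖ ≤ R → d ≤ dist z (D.pt 1)) → 0 < δ → 2 * δ ≤ d → 0 < m → m < r → ∀ {qp qm : ℂ} (L : Path qp qm), (∀ t, L t ∈ B ∧ r - m ≤ ‖g (L t)‖ ∧ ‖g (L t)‖ ≤ r + m) → arg (g qp) = 0 → arg (g qm) = Real.pi → ∀ {u v : Site 2} (W : (discreteDomainGraph D.carrier δ).Walk u v), ‖φ.symm (meshPoint δ u)‖ ≤ r - m → r + m ≤ ‖φ.symm (meshPoint δ v)‖ → (∀ e ∈ W.darts, ‖φ.symm (meshPoint δ e.fst)‖ ≤ R) → ∃ y ∈ range L, ∃ e ∈ W.darts, y ∈ segment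 ℝ (meshPoint δ e.fst) (meshPoint δ e.snd) :=
  fun hBc hgB hginj hgeq hgim hmemB hfar hδ hδd hm hmr _ _ L hL hqp hqm _ _ W hu hv hW =>
    exists_dart_of_crosscut hBc hgB hginj hgeq hgim hmemB hfar hδ hδd hm hmr L hL hqp hqm W hu hv hW

end Summit.CriticalPhenomena.SAWScalingLimit.Theorems.IsingBoundaryRatio

end
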